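/-
Copyright (c) 2026 the pub-hodgecm-mathlib formalisation cell (harness21).  Prover seat hodgecm-mathlib-F0P3a-p03 (g20), 2026-09-02 (LH7 leaf ED. 3 road, O8b census:
the ★ half «LINE UNIQUENESS» of the print letter `PKmultOneU2Shape`).
-/
import Literature.NumberTheory.Automorphic.AutomorphicCharacterLine
import HarnessLib

/-!
# Multiplicity one for automorphic characters of an ARBITRARY adelic datum: the `ψ⁻¹`-eigenspace of the regular representation in
# `L²(G(𝔸_K) ⧸ A_G G(K), μ)` is the line `ℂ [ψ̄]`

Topic `NumberTheory/Automorphic`; namespace `Literature.NumberTheory.Automorphic` (dot notation on ★ `AdelicGroupData.AutomorphicCharacter` and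
★ `DiscreteAutomorphicRep`).  THEOREMS ONLY: no definition, no named fact, no instance, no notation, no `sorry`.  Sequel of ★ `AutomorphicCharacterLine`
(F0P3a-p03 (g19), p849889), whose §4 dictionary `eq_ofChar_iff` carries a commutativity hypothesis `hcomm` that only its `→` half (the DEFINITION of the
eigencharacter of an arbitrary irreducible `P`) uses.  Here the `←` half is proved for EVERY datum with `G(𝔸_K)` locally compact second countable:

THE MATHEMATICS ([Gelbart1975] proof of Thm. 10.10, p. 158; ergodicity of `G(𝔸_K)` on its automorphic quotient, ★ `AutomorphicQuotientErgodic`).  Let `ψ`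
be a unitary automorphic character of `G(𝔸_K)` (★ `AutomorphicCharacter`) and `a = [ψ̄] ∈ L²` its non-zero class, `R(g) a = ψ(g)⁻¹ a` (★ `rightRegular_toL2`).
If `f ∈ L²` satisfies `R(g) f = ψ(g)⁻¹ f` for all `g`, then `f - (⟪a,f⟫∕⟪a,a⟫) a` is a `ψ⁻¹`-eigenfunction ORTHOGONAL to `a`, hence `0` by ★
`eq_zero_of_inner_eq_zero_of_rightRegular_apply_eq_smul` (two eigenfunctions of the same character have `f ḡ` invariant, so a.e. constant, so they
cannot be orthogonal unless one vanishes).  Hence: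
* §1 `AutomorphicCharacter.mem_lineSubrep_of_forall_rightRegular_apply_eq_smul` ∕ `mem_lineSubrep_iff_forall_rightRegular_apply_eq_smul` — **the
  `ψ⁻¹`-eigenspace of `R` IS the line `ℂ [ψ̄]`** (★ `lineSubrep`); `closedSubrep_le_lineSubrep_of_forall_apply_eq_smul`,
  `closedSubrep_eq_lineSubrep_of_forall_apply_eq_smul` — a (non-zero) closed invariant subspace on which `G(𝔸_K)` acts by the scalars `ψ(g)⁻¹` is
  (contained in) the line;
* §2 `DiscreteAutomorphicRep.eq_ofChar_of_forall_apply_eq_smul` — **a discrete automorphic representation on which `G(𝔸_K)` acts by `ψ(g)⁻¹` IS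
  `ofChar ψ μ`**; `eq_ofChar_iff_forall_apply_eq_smul` (the `hcomm`-free form of ★ `eq_ofChar_iff`); `eq_of_forall_apply_eq_smul` — **MULTIPLICITY ONE
  FOR AUTOMORPHIC CHARACTERS**: two discrete automorphic representations with the same scalar action of `G(𝔸_K)` coincide; `isOneDimensional_of_forall_apply_eq_smul`.
No commutativity anywhere.  Consumer (cell `hodgecm-mathlib`, crux H413 = stmt-HodgeConjecture-24833, line LH7): the in-house half of the print letter O8b
`PKmultOneU2Shape` (multiplicity one for one-dimensional automorphic representations of the quasi-split `U(2)`), whose remaining PRINT half is the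
ISOTYPY «a discrete automorphic `P₂` realising the character family `χ_v` at every finite place is `χ`-scalar» ([Rogawski1990] §13.3 p. 203).
HONEST LABEL: generic `L²` bookkeeping; HC_CM is proved only modulo the printed citations of that programme until its rung 0 closes; this file proves no
printed citation of it.

## References
* [Gelbart1975] S. Gelbart, *Automorphic forms on adele groups*, Ann. of Math. Stud. 83 (1975), §2.A; Thm. 10.10 (proof, p. 158).
* [DeitmarEchterhoff2014] A. Deitmar, S. Echterhoff, *Principles of Harmonic Analysis*, 2nd ed. (2014), Example 6.1.10, Thm. 9.2.2.
-/

set_option autoImplicit false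

noncomputable section

open MeasureTheory NumberField
open scoped InnerProductSpace

namespace Literature.NumberTheory.Automorphic

universe u

/-! ## §1 The `ψ⁻¹`-eigenspace of the regular representation is the line `ℂ [ψ̄]` -/

namespace AdelicGroupData.AutomorphicCharacter

variable {K : Type} [Field K] [NumberField K] {𝒢 : AdelicGroupData.{u} K}
  [LocallyCompactSpace 𝒢.Adelic] [SecondCountableTopology 𝒢.Adelic]
  (ψ : 𝒢.AutomorphicCharacter) (μ : Measure 𝒢.automorphicQuotient) [𝒢.IsAutomorphicMeasure μ]

/-- **An `L²` eigenfunction of the regular representation with eigencharacter `ψ⁻¹` is a multiple of `[ψ̄]`**: if `R(g) f = ψ(g)⁻¹ f` for every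
`g ∈ G(𝔸_K)` then `f ∈ ℂ [ψ̄]` (★ `lineSubrep`).  The component of `f` orthogonal to `a = [ψ̄]` is a `ψ⁻¹`-eigenfunction orthogonal to the
`ψ⁻¹`-eigenfunction `a ≠ 0`, hence `0` (★ `eq_zero_of_inner_eq_zero_of_rightRegular_apply_eq_smul`, ergodicity).  No commutativity of `G(𝔸_K)` is used.
[cite: Gelbart1975, Thm. 10.10 (proof, p. 158)] -/
theorem mem_lineSubrep_of_forall_rightRegular_apply_eq_smul {f : 𝒢.L2 μ}
    (hf : ∀ g : 𝒢.Adelic, 𝒢.rightRegular μ g f = ((ψ g : ℂˣ) : ℂ)⁻¹ • f) : f ∈ ψ.lineSubrep μ := by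
  have ha : ∀ g : 𝒢.Adelic, 𝒢.rightRegular μ g (ψ.toL2 μ) = (fun g : 𝒢.Adelic => ((ψ g : ℂˣ) : ℂ)⁻¹) g • ψ.toL2 μ := fun g =>
    ψ.rightRegular_toL2 μ g
  have hb : ∀ g : 𝒢.Adelic, 𝒢.rightRegular μ g f = (fun g : 𝒢.Adelic => ((ψ g : ℂˣ) : ℂ)⁻¹) g • f := hf
  have ha0 : ψ.toL2 μ ≠ 0 := ψ.toL2_ne_zero μ
  -- the component of `f` orthogonal to `[ψ̄]`
  have hh : ∀ g : 𝒢.Adelic, 𝒢.rightRegular μ g (f - (⟪ψ.toL2 μ, f⟫_ℂ / ⟪ψ.toL2 μ, ψ.toL2 μ⟫_ℂ) • ψ.toL2 μ) =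
      (fun g : 𝒢.Adelic => ((ψ g : ℂˣ) : ℂ)⁻¹) g • (f - (⟪ψ.toL2 μ, f⟫_ℂ / ⟪ψ.toL2 μ, ψ.toL2 μ⟫_ℂ) • ψ.toL2 μ) := by
    intro g
    rw [map_sub, map_smul, ha g, hb g, smul_sub, smul_comm]
  have horth : ⟪ψ.toL2 μ, f - (⟪ψ.toL2 μ, f⟫_ℂ / ⟪ψ.toL2 μ, ψ.toL2 μ⟫_ℂ) • ψ.toL2 μ⟫_ℂ = 0 := by
    rw [inner_sub_right, inner_smul_right, div_mul_cancel₀ _ (inner_self_ne_zero.2 ha0), sub_self]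
  have h0 : f - (⟪ψ.toL2 μ, f⟫_ℂ / ⟪ψ.toL2 μ, ψ.toL2 μ⟫_ℂ) • ψ.toL2 μ = 0 :=
    𝒢.eq_zero_of_inner_eq_zero_of_rightRegular_apply_eq_smul μ ha hh ha0 horth
  rw [sub_eq_zero] at h0
  exact (ψ.mem_lineSubrep_iff μ f).2 ⟨_, h0.symm⟩

/-- **The `ψ⁻¹`-eigenspace of `R` in `L²` is exactly the line `ℂ [ψ̄]`.** [cite: Gelbart1975, §2.A; Thm. 10.10 (proof, p. 158)] -/
theorem mem_lineSubrep_iff_forall_rightRegular_apply_eq_smul (f : 𝒢.L2 μ) :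
    f ∈ ψ.lineSubrep μ ↔ ∀ g : 𝒢.Adelic, 𝒢.rightRegular μ g f = ((ψ g : ℂˣ) : ℂ)⁻¹ • f := by
  refine ⟨fun hf g => ?_, ψ.mem_lineSubrep_of_forall_rightRegular_apply_eq_smul μ⟩
  obtain ⟨a, rfl⟩ := (ψ.mem_lineSubrep_iff μ f).1 hf
  rw [map_smul, ψ.rightRegular_toL2 μ g, smul_comm]

/-- **A closed invariant subspace of `L²` on which `G(𝔸_K)` acts by the scalars `ψ(g)⁻¹` lies in the line `ℂ [ψ̄]`.** [cite: Gelbart1975, Thm. 10.10 (proof, p. 158)] -/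
theorem closedSubrep_le_lineSubrep_of_forall_apply_eq_smul {W : ContRepresentation.ClosedSubrep (𝒢.rightRegular μ)}
    (hW : ∀ (g : 𝒢.Adelic) (v : W.toSubmodule), W.toContRep g v = ((ψ g : ℂˣ) : ℂ)⁻¹ • v) : W ≤ ψ.lineSubrep μ := by
  intro v hv
  refine ψ.mem_lineSubrep_of_forall_rightRegular_apply_eq_smul μ fun g => ?_
  have h1 := congrArg Subtype.val (hW g ⟨v, hv⟩)
  rw [ContRepresentation.ClosedSubrep.coe_toContRep_apply] at h1
  exact h1

/-- **A NON-ZERO closed invariant subspace of `L²` on which `G(𝔸_K)` acts by the scalars `ψ(g)⁻¹` IS the line `ℂ [ψ̄]`** (it lies in the line, which is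
topologically irreducible, ★ `isTopIrreducible_lineSubrep`). [cite: Gelbart1975, Thm. 10.10 (proof, p. 158)] -/
theorem closedSubrep_eq_lineSubrep_of_forall_apply_eq_smul {W : ContRepresentation.ClosedSubrep (𝒢.rightRegular μ)}
    (hW : ∀ (g : 𝒢.Adelic) (v : W.toSubmodule), W.toContRep g v = ((ψ g : ℂˣ) : ℂ)⁻¹ • v) (hnt : Nontrivial W.toSubmodule) :
    W = ψ.lineSubrep μ :=
  ContRepresentation.ClosedSubrep.eq_of_le_of_isTopIrreducible (ψ.isTopIrreducible_lineSubrep μ) hnt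
    (ψ.closedSubrep_le_lineSubrep_of_forall_apply_eq_smul μ hW)

end AdelicGroupData.AutomorphicCharacter

/-! ## §2 Discrete automorphic representations with a scalar action: multiplicity one for automorphic characters -/

namespace DiscreteAutomorphicRep

variable {K : Type} [Field K] [NumberField K] {𝒢 : AdelicGroupData.{u} K}
  [LocallyCompactSpace 𝒢.Adelic] [SecondCountableTopology 𝒢.Adelic]
  (μ : Measure 𝒢.automorphicQuotient) [𝒢.IsAutomorphicMeasure μ]

omit [LocallyCompactSpace 𝒢.Adelic] [SecondCountableTopology 𝒢.Adelic] in
/-- Two discrete automorphic representations with the same space are equal (the other field is a proposition); private copy of the private ★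
`eq_of_space_eq` of `AutomorphicCharacterLine`. [cite: Gelbart1975, §2.A] -/
private theorem eq_of_space_eq' {P P' : DiscreteAutomorphicRep 𝒢 μ} (h : P.space = P'.space) : P = P' := by
  cases P
  cases P'
  cases h
  rfl

/-- **A discrete automorphic representation on which `G(𝔸_K)` acts by the scalars `ψ(g)⁻¹` IS the line of `ψ`**: `P = ofChar ψ μ` (★ `DiscreteAutomorphicRep.ofChar`)
— for EVERY datum (no commutativity): `P.space` is non-zero (★ `nontrivial_space`) and lies in the `ψ⁻¹`-eigenspace `ℂ [ψ̄]` (§1).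
[cite: Gelbart1975, Thm. 10.10 (proof, p. 158)] [cite: DeitmarEchterhoff2014, Example 6.1.10] -/
theorem eq_ofChar_of_forall_apply_eq_smul (P : DiscreteAutomorphicRep 𝒢 μ) (ψ : 𝒢.AutomorphicCharacter)
    (h : ∀ (g : 𝒢.Adelic) (f : P.space.toSubmodule), P.space.toContRep g f = ((ψ g : ℂˣ) : ℂ)⁻¹ • f) : P = ofChar ψ μ :=
  eq_of_space_eq' μ ((ψ.closedSubrep_eq_lineSubrep_of_forall_apply_eq_smul μ h P.nontrivial_space).trans (ofChar_space ψ μ).symm)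

/-- **`P = ofChar ψ μ ↔ R(g)|_P = ψ(g)⁻¹`** — the dictionary entry ★ `eq_ofChar_iff` WITHOUT its commutativity hypothesis. [cite: Gelbart1975, §2.A; Thm. 10.10 (proof, p. 158)] -/
theorem eq_ofChar_iff_forall_apply_eq_smul (P : DiscreteAutomorphicRep 𝒢 μ) (ψ : 𝒢.AutomorphicCharacter) :
    P = ofChar ψ μ ↔ ∀ (g : 𝒢.Adelic) (f : P.space.toSubmodule), P.space.toContRep g f = ((ψ g : ℂˣ) : ℂ)⁻¹ • f := by
  constructor
  · rintro rfl g f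
    exact ofChar_toContRep_apply ψ μ g f
  · exact P.eq_ofChar_of_forall_apply_eq_smul μ ψ

/-- **MULTIPLICITY ONE FOR AUTOMORPHIC CHARACTERS (any datum)**: two discrete automorphic representations in `L²(G(𝔸_K) ⧸ A_G G(K), μ)` on which `G(𝔸_K)` acts
through the scalars `ψ(g)⁻¹` of the SAME unitary automorphic character `ψ` are EQUAL (both are `ofChar ψ μ`). [cite: Gelbart1975, Thm. 10.10 (proof, p. 158)] -/
theorem eq_of_forall_apply_eq_smul (P P' : DiscreteAutomorphicRep 𝒢 μ) (ψ : 𝒢.AutomorphicCharacter)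
    (h : ∀ (g : 𝒢.Adelic) (f : P.space.toSubmodule), P.space.toContRep g f = ((ψ g : ℂˣ) : ℂ)⁻¹ • f)
    (h' : ∀ (g : 𝒢.Adelic) (f : P'.space.toSubmodule), P'.space.toContRep g f = ((ψ g : ℂˣ) : ℂ)⁻¹ • f) : P = P' := by
  rw [P.eq_ofChar_of_forall_apply_eq_smul μ ψ h, P'.eq_ofChar_of_forall_apply_eq_smul μ ψ h']

/-- A discrete automorphic representation with a scalar action of `G(𝔸_K)` through a unitary automorphic character is ONE-DIMENSIONAL (★ `IsOneDimensional`).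
[cite: Gelbart1975, §2.A] -/
theorem isOneDimensional_of_forall_apply_eq_smul (P : DiscreteAutomorphicRep 𝒢 μ) (ψ : 𝒢.AutomorphicCharacter)
    (h : ∀ (g : 𝒢.Adelic) (f : P.space.toSubmodule), P.space.toContRep g f = ((ψ g : ℂˣ) : ℂ)⁻¹ • f) : P.IsOneDimensional := by
  rw [P.eq_ofChar_of_forall_apply_eq_smul μ ψ h]
  exact isOneDimensional_ofChar ψ μ

/-- The scalar action read on the ambient `L²`: if `R(g) f = ψ(g)⁻¹ f` for every `f ∈ P.space`, then `P = ofChar ψ μ`. [cite: Gelbart1975, Thm. 10.10 (proof, p. 158)] -/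
theorem eq_ofChar_of_forall_rightRegular_apply_eq_smul (P : DiscreteAutomorphicRep 𝒢 μ) (ψ : 𝒢.AutomorphicCharacter)
    (h : ∀ (g : 𝒢.Adelic) (f : 𝒢.L2 μ), f ∈ P.space → 𝒢.rightRegular μ g f = ((ψ g : ℂˣ) : ℂ)⁻¹ • f) : P = ofChar ψ μ :=
  P.eq_ofChar_of_forall_apply_eq_smul μ ψ fun g f => Subtype.ext (by
    rw [ContRepresentation.ClosedSubrep.coe_toContRep_apply]
    exact h g f f.2)

end DiscreteAutomorphicRep

end Literature.NumberTheory.Automorphic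

end
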